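import Mathlib.Data.List.Basic

/-!
HONEST FRAMING: per-curve certified theorems and census instruments; no claim on BSD in rank ≥ 2.

# Rank-2 observatory — merge certificates for chunk COMPLETENESS theorems

The census chunks `rank2Rows00 … ` (conductor-ordered lists of `Rank2Row`) are covered by the
aggregated kernel-certificate indices `kernelCertRows<S>` (each a `Sublist` of one chunk, each with a
theorem `∀ r ∈ kernelCertRows<S>, 2 ≤ rank_ℤ E_r(ℚ)`). To turn "every index row is certified" into
"every CHUNK row is certified" cheaply inside the kernel we use a MERGE CERTIFICATE: an instruction
stream `tags : List ℕ`, each tag popping the head of the designated index list; the claim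
`interleave tags [kernelCertRows<S₁>, …] = rank2Rows<c>` is decided by the kernel in `O(n · k)` steps
(no quadratic membership search), and `forall_mem_interleave` transports a property holding on every
list to every element of the merge. Pure list combinatorics; no arithmetic.

[folklore]
-/

namespace Summit.BirchSwinnertonDyer.BirchSwinnertonDyer.Rank2Observatory

variable {α : Type*}

/-- Pop the head of the `j`-th list of `ls`: the popped element together with the updated family,
or `none` if the index is out of range or that list is empty. [folklore] -/
def popAt : List (List α) → ℕ → Option (α × List (List α))
  | [], _ => none
  | [] :: _, 0 => none
  | (a :: l) :: ls, 0 => some (a, l :: ls)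
  | l :: ls, j + 1 =>
    match popAt ls j with
    | none => none
    | some (a, ls') => some (a, l :: ls')

/-- The merge of the family `ls` along the instruction stream `tags` (tag `j` emits the current head of
the `j`-th list); stops at the first invalid instruction. [folklore] -/
def interleave : List ℕ → List (List α) → List α
  | [], _ => []
  | j :: js, ls =>
    match popAt ls j with
    | none => []
    | some (a, ls') => a :: interleave js ls'

/-- A property holding on every member of every list of the family holds on a popped element and on
every member of the updated family. [folklore] -/
theorem forall_popAt {P : α → Prop} : ∀ (ls : List (List α)) (j : ℕ) {a : α} {ls' : List (List α)},
    popAt ls j = some (a, ls') → (∀ l ∈ ls, ∀ x ∈ l, P x) → P a ∧ ∀ l ∈ ls', ∀ x ∈ l, P x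
  | [], _, _, _, h, _ => by simp [popAt] at h
  | [] :: _, 0, _, _, h, _ => by simp [popAt] at h
  | (b :: l) :: ls, 0, a, ls', h, hP => by
    simp only [popAt, Option.some.injEq, Prod.mk.injEq] at h
    obtain ⟨rfl, rfl⟩ := h
    refine ⟨hP (b :: l) List.mem_cons_self b List.mem_cons_self, fun l' hl' x hx => ?_⟩
    rcases List.mem_cons.mp hl' with h' | hl'
    · rw [h'] at hx; exact hP (b :: l) List.mem_cons_self x (List.mem_cons_of_mem b hx)
    · exact hP l' (List.mem_cons_of_mem _ hl') x hx
  | l :: ls, j + 1, a, ls', h, hP => by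
    cases hq : popAt ls j with
    | none => simp [popAt, hq] at h
    | some p =>
      obtain ⟨b, ls''⟩ := p
      simp only [popAt, hq, Option.some.injEq, Prod.mk.injEq] at h
      obtain ⟨rfl, rfl⟩ := h
      have ih := forall_popAt ls j hq fun l' hl' => hP l' (List.mem_cons_of_mem _ hl')
      refine ⟨ih.1, fun l' hl' x hx => ?_⟩
      rcases List.mem_cons.mp hl' with h' | hl'
      · rw [h'] at hx; exact hP l List.mem_cons_self x hx
      · exact ih.2 l' hl' x hx

/-- **Transport along a merge**: a property holding on every member of every list of the family holds on
every element of `interleave tags ls`. [folklore] -/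
theorem forall_mem_interleave {P : α → Prop} : ∀ (tags : List ℕ) (ls : List (List α)),
    (∀ l ∈ ls, ∀ x ∈ l, P x) → ∀ x ∈ interleave tags ls, P x
  | [], _, _ => by simp [interleave]
  | j :: js, ls, hP => by
    intro x hx
    cases hq : popAt ls j with
    | none => simp [interleave, hq] at hx
    | some p =>
      obtain ⟨a, ls'⟩ := p
      simp only [interleave, hq, List.mem_cons] at hx
      have h := forall_popAt ls j hq hP
      rcases hx with rfl | hx
      · exact h.1
      · exact forall_mem_interleave js ls' h.2 x hx

/-- Sanity example: a three-way merge. [folklore] -/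
example : interleave [0, 2, 1, 0, 1] [[1, 4], [3, 5], [2]] = [1, 2, 3, 4, 5] := by decide

end Summit.BirchSwinnertonDyer.BirchSwinnertonDyer.Rank2Observatory
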